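/-
Copyright (c) 2026 the pub-hodgecm-mathlib formalisation cell (harness21).  Prover seat hodgecm-mathlib-LH4-p08 (g11) (valve hand), Track B «K2-LIT»,
#184♮ = hLiu418 = `stmt-HodgeConjecture-24832`; socket #41, KIND W, (x-b) side — KIND-W byte desk K2E4-p10 (g9) 2026-09-04T23:04:55Z (2) under LEAD F0P6-plan (g14):
«THE INDEFINITE-INDEX TWIN of ★ `archGrowth_le_heightDecay`» (consumer-side face of the (E3-d) «Φ6b-ind» organ).
THEOREMS ONLY (no `def`, no `instance`, no notation, no named-fact hypothesis, no `sorry`).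
-/
import Summits.HodgeConjecture.HodgeConjecture.Theorems.K2LiuSiegelEisensteinKindWArchBlock     -- ★ the positive-index twin (+ ★ G7-C, G7-B, G7-A through it)
import HarnessLib

/-!
# Crux `HLiu418`, socket #41, KIND W — `K2LiuSiegelEisensteinKindWArchBlockIndefinite`: THE THREE-FACTOR ARCHIMEDEAN GROWTH AT AN INDEFINITE INDEX,
# ENTRY LETTERS (PURELY METRIC) ⟹ THE (D-loc) SHAPE

Cell `hodgecm-mathlib`, crux item hLiu418 = `stmt-HodgeConjecture-24832` (helper lane `--supports … --as helper`, count-neutral), route of record `HCCMUnconditional`;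
squad K2 ∕ K2Liu, road `K2_Liu`, socket #41 `sig_K2LiuSiegelEisensteinContinuation`, KIND W.  Twin of ★ `K2LiuSiegelEisensteinKindWArchBlock.archGrowth_le_heightDecay`
for a NON-DEGENERATE index of any signature, PURELY METRIC (byte desk K2E4-p10 (g9) 2026-09-04T23:11:54Z): at a complex place the continued confluent hypergeometric
function at an indefinite index is bounded locally uniformly by `A · e^{−c·τ(Z)} (1 + μ(Z)^{−B})` with `τ(Z) = Σ_i |λ_i(Z)|` the trace norm of the twisted index
`Z = yᴴ x y` (Shimura 1982, Math. Ann. 260, Thm. 3.1 ∕ Prop. 3.3; the `μ^{−B}` factor is absorbed by the payer into `(1 + τ)^{N} |det Z|^{−N′}`); here the trace norm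
enters only as a BY-VALUE letter `t σ` squeezed between the entries of `Z σ := (y σ)ᴴ x σ y σ` (`‖(Z σ) a b‖ ≤ t σ ≤ Kt · Σ_{a,b} ‖(Z σ) a b‖`), so NO hermitian-ness,
NO positivity and NO spectral theory are used; the block decomposition at the point is ★-produced by `K2LiuSiegelEisensteinKindWBlockAtPoint.exists_blockDecomposition_archAt`.
* §1 metric block algebra: `norm_apply_conjTranspose_mul_mul_le` (`‖(yᴴ x y) a b‖ ≤ R²·Σ_{cd} ‖x c d‖`), `eq_conjTranspose_inv_mul_mul_inv` (`x = y⁻ᴴ (yᴴ x y) y⁻¹` from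
  `y y⁻¹ = 1`), `norm_det_conjTranspose_mul_mul` (`‖det(yᴴ x y)‖ = ‖det x‖·‖det y‖²`);
* §2 **`archGrowth_le_heightDecay_of_entryLetters`** — THE FACE: ★ G7 frame BY VALUE (minus `hT′`), growth rate `cg > 0`, real exponents `Ng, N′g ≥ 0`, `Kt ≥ 1`,
  ℕ targets `N₁ ≥ Ng·#S`, `N′₁ ≥ N′g`, `K ≥ 1`; for every `h`, every block decomposition, every `x : S → M_p(ℂ)` with `det (x σ) ≠ 0`, every by-value size
  `t : S → ℝ` with the two entry letters, and every `τ` with `τ ≤ Σ_σ Σ_{a,b} ‖x σ a b‖ ≤ K τ`: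
  `∏_σ e^{−cg t σ} (1 + t σ)^{Ng} (1 + ‖det((y σ)ᴴ x σ y σ)‖^{−N′g}) ≤ C ‖h‖^a (e^{−c₁ ‖h‖^{−2} τ} (1 + τ)^{N₁}) ∏_σ (1 + ‖det x σ‖⁻¹)^{N′₁}`.
  (i) decay WITHOUT a positivity floor: `Σ‖x σ‖ ≤ |p|⁴ c_B² ‖h‖² · t σ` from `x = y⁻ᴴ Z y⁻¹` and ★ `block_entry_bounds` ⇒ `c₁ = cg · (|p|⁴c_B²)⁻¹`;
  (ii) `t σ ≤ Kt |p|² c_B² ‖h‖² Σ‖x σ‖` ⇒ the `B = K₂‖h‖²(1 + Σ u)` road of the ★ positive twin; (iii) `‖det Z σ‖ = ‖det x σ‖·‖det y σ‖²` + ★ `rpow_neg_re_det_le` +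
  ★ `one_add_mul_rpow_neg_le_mul` ∕ `one_add_rpow_neg_le_two_mul_pow`.
Shimura 1982 (Math. Ann. 260), Thm. 3.1 ∕ Prop. 3.3 (prose reference; no registered bib key); [MoeglinWaldspurger1995, I.2.2, II.1.5] [BorelJacquet1979, §1.2, §4.1] [Shimura1997, §A3].
HONEST LABEL.  Count-neutral helper, closes no socket: `HC_CM` is proved only modulo the 7 printed citations (2 remaining named inputs: hLiu418 =
`stmt-HodgeConjecture-24832`, h413 = `stmt-HodgeConjecture-24833`) until rung 0 closes.
-/

set_option autoImplicit false
set_option linter.dupNamespace false -- the mandated namespace repeats `HodgeConjecture.HodgeConjecture`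

noncomputable section

open scoped BigOperators ComplexOrder Matrix
-- `Classical` is needed to see the Mathlib normed-ring instances on `mixedSpace E` (note H5 of `AdelicGLnGlue`)
open scoped Classical
open Finset

namespace Summit.HodgeConjecture.HodgeConjecture.Cruxes.HLiu418.K2LiuSiegelEisensteinKindWArchBlockIndefinite

open Summit.HodgeConjecture.HodgeConjecture.Cruxes.HLiu418.K2LiuArchBlockHeightBound
open Summit.HodgeConjecture.HodgeConjecture.Cruxes.HLiu418.K2LiuIwasawaHeightLatticeSumBound
open Summit.HodgeConjecture.HodgeConjecture.Cruxes.HLiu418.K2LiuSiegelEisensteinKindWArchBlock (one_add_mul_rpow_neg_le_mul one_add_rpow_neg_le_two_mul_pow)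

/-! ## §1 Metric block algebra -/

section Block

variable {p : Type*} [Fintype p] [DecidableEq p]

omit [DecidableEq p] in
/-- **entries of a congruence**: `‖(yᴴ x y) a b‖ ≤ R² · Σ_{c,d} ‖x c d‖` when the entries of `y` are `≤ R` (`R ≥ 0`). [folklore] -/
theorem norm_apply_conjTranspose_mul_mul_le {x y : Matrix p p ℂ} {R : ℝ} (hR : 0 ≤ R) (hy : ∀ i j, ‖y i j‖ ≤ R) (a b : p) :
    ‖(yᴴ * x * y) a b‖ ≤ R ^ 2 * ∑ c, ∑ d, ‖x c d‖ := by
  have hexp : (yᴴ * x * y) a b = ∑ d, ∑ c, star (y c a) * x c d * y d b := by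
    rw [Matrix.mul_apply]
    refine Finset.sum_congr rfl fun d _ => ?_
    rw [Matrix.mul_apply, Finset.sum_mul]
    refine Finset.sum_congr rfl fun c _ => ?_
    rw [Matrix.conjTranspose_apply]
  rw [hexp, Finset.sum_comm, Finset.mul_sum]
  refine (norm_sum_le _ _).trans (Finset.sum_le_sum fun c _ => ?_)
  rw [Finset.mul_sum]
  refine (norm_sum_le _ _).trans (Finset.sum_le_sum fun d _ => ?_)
  rw [norm_mul, norm_mul, norm_star]
  calc ‖y c a‖ * ‖x c d‖ * ‖y d b‖ ≤ R * ‖x c d‖ * R := mul_le_mul (mul_le_mul_of_nonneg_right (hy c a) (norm_nonneg _)) (hy d b) (norm_nonneg _) (by positivity)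
    _ = R ^ 2 * ‖x c d‖ := by ring

/-- undoing a congruence by an invertible block: `x = (y⁻¹)ᴴ · (yᴴ x y) · y⁻¹` when `y y⁻¹ = 1`. [folklore] -/
theorem eq_conjTranspose_inv_mul_mul_inv {x y : Matrix p p ℂ} (hy : y * y⁻¹ = 1) : x = (y⁻¹)ᴴ * (yᴴ * x * y) * y⁻¹ := by
  have hy' : y⁻¹ * y = 1 := Matrix.nonsing_inv_mul y (Matrix.isUnit_det_of_right_inverse hy)
  have h1 : (y⁻¹)ᴴ * yᴴ = 1 := by rw [← Matrix.conjTranspose_mul, hy, Matrix.conjTranspose_one]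
  calc x = ((y⁻¹)ᴴ * yᴴ) * x * (y * y⁻¹) := by rw [h1, hy, Matrix.one_mul, Matrix.mul_one]
    _ = (y⁻¹)ᴴ * (yᴴ * x * y) * y⁻¹ := by simp only [Matrix.mul_assoc]

/-- `‖det (yᴴ x y)‖ = ‖det x‖ · ‖det y‖²`. [folklore] -/
theorem norm_det_conjTranspose_mul_mul (x y : Matrix p p ℂ) : ‖(yᴴ * x * y).det‖ = ‖x.det‖ * ‖y.det‖ ^ 2 := by
  rw [Matrix.det_mul, Matrix.det_mul, Matrix.det_conjTranspose, norm_mul, norm_mul, norm_star]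
  ring

end Block

/-! ## §2 The face at an indefinite index (purely metric: the trace norm as a by-value letter `t σ`) -/

section Face

open NumberField NumberField.mixedEmbedding NumberField.InfinitePlace IsDedekindDomain
open Literature.NumberTheory.Automorphic Literature.NumberTheory.Automorphic.UnitaryGroup

variable (F E : Type) [Field F] [NumberField F] [Field E] [NumberField E] [Algebra F E] (c : E ≃ₐ[F] E) (N : ℕ) (J : Matrix (Fin N) (Fin N) E)
variable {S p : Type*} [Fintype S] [Fintype p] [DecidableEq p]

/-- **THREE-FACTOR ARCHIMEDEAN GROWTH AT AN INDEFINITE INDEX, ENTRY LETTERS ⟹ THE (D-loc) SHAPE** (KIND-W byte desk K2E4-p10 (g9) 2026-09-04T23:11:54Z bytes).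
Frame data BY VALUE as in ★ `archGrowth_le_heightDecay` (minus `hT′`, derived inside by `mul_eq_one_comm`); growth data BY VALUE: rate `cg > 0`, real exponents
`Ng, N′g ≥ 0`; a comparison constant `Kt ≥ 1` squeezing the by-value size `t σ` of the twisted index `Z σ = (y σ)ᴴ x σ y σ` between its entries
(`‖(Z σ) a b‖ ≤ t σ ≤ Kt · Σ_{a,b} ‖(Z σ) a b‖` — e.g. `t σ = Σ_i |λ_i(Z σ)|`, the trace norm of Shimura 1982, Thm. 3.1 ∕ Prop. 3.3, with `Kt = |p|`); ℕ targets
`N₁ ≥ Ng·#S`, `N′₁ ≥ N′g`; a comparison constant `K ≥ 1` for the TOP's size `τ` against the block size `Σ_{a,b} ‖x σ a b‖`.  NO hermitian-ness, NO positivity: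
`x σ` is only asked to be non-degenerate.  CONCLUSION: `∃ C a c₁` (frame + growth data only) with
  `∏_σ e^{−cg t σ} (1 + t σ)^{Ng} (1 + ‖det((y σ)ᴴ x σ y σ)‖^{−N′g}) ≤ C · ‖h‖^a · (e^{−c₁ ‖h‖^{−2} τ} · (1 + τ)^{N₁}) · ∏_σ (1 + ‖det x σ‖⁻¹)^{N′₁}`
— ★ `K2LiuSiegelEisensteinKindWDecay.hdec_of_letters`' `hloc` right-hand side with `a′ = 2`, the determinant defect in block currency.
(i) `Σ_{cd}‖x σ c d‖ ≤ |p|⁴c_B²‖h‖² · t σ` (`x = y⁻ᴴ Z y⁻¹`, ★ `block_entry_bounds`) — no positivity floor; (ii) `t σ ≤ Kt|p|²c_B²‖h‖² · Σ‖x σ‖`;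
(iii) `‖det Z σ‖ = ‖det x σ‖·‖det y σ‖²` + ★ `rpow_neg_re_det_le` + ★ `one_add_mul_rpow_neg_le_mul` ∕ `one_add_rpow_neg_le_two_mul_pow`.
[cite: MoeglinWaldspurger1995, II.1.5] [cite: BorelJacquet1979, §1.2, §4.1] [cite: Shimura1997, §A3] -/
theorem archGrowth_le_heightDecay_of_entryLetters [NeZero N] [Nonempty p] (hc : c ≠ 1) (w : S → {w : InfinitePlace E // IsComplex w})
    (hw : ∀ σ, c • (w σ).1 = (w σ).1) (r : p ⊕ p ≃ Fin N) (T Tinv : S → Matrix (p ⊕ p) (p ⊕ p) ℂ) (hT : ∀ σ, T σ * Tinv σ = 1)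
    {M : ℝ} (hM : 1 ≤ M) (hTe : ∀ σ i j, ‖T σ i j‖ ≤ M) (hTe' : ∀ σ i j, ‖Tinv σ i j‖ ≤ M)
    {cg : ℝ} (hcg : 0 < cg) {Ng N'g : ℝ} (hNg : 0 ≤ Ng) (hN'g : 0 ≤ N'g) {Kt : ℝ} (hKt : 1 ≤ Kt)
    {N₁ N'₁ : ℕ} (hN₁ : Ng * Fintype.card S ≤ N₁) (hN'₁ : N'g ≤ N'₁) {K : ℝ} (hK : 1 ≤ K) :
    ∃ C a c₁ : ℝ, 0 ≤ C ∧ 0 ≤ a ∧ 0 < c₁ ∧ ∀ (h : (adelicGroupData F E c N J).Adelic) (y b d : S → Matrix p p ℂ) (κ κ' : S → Matrix (p ⊕ p) (p ⊕ p) ℂ),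
      (∀ σ, κ σ * κ' σ = 1) → (∀ σ, κ' σ * κ σ = 1) → (∀ σ i j, ‖κ σ i j‖ ≤ M) → (∀ σ i j, ‖κ' σ i j‖ ≤ M) →
      (∀ σ, T σ * Matrix.reindex r.symm r.symm
          ((((archAt F E c N J (w σ) (hw σ) hc (archPart F E c N J h) : archLocal E N J (w σ)) : GL (Fin N) ℂ) : Matrix (Fin N) (Fin N) ℂ)) *
          Tinv σ = Matrix.fromBlocks (y σ) (b σ) 0 (d σ) * κ σ) →
      ∀ x : S → Matrix p p ℂ, (∀ σ, (x σ).det ≠ 0) →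
      ∀ t : S → ℝ, (∀ σ a b, ‖((y σ)ᴴ * x σ * y σ) a b‖ ≤ t σ) → (∀ σ, t σ ≤ Kt * ∑ a, ∑ b, ‖((y σ)ᴴ * x σ * y σ) a b‖) →
      ∀ τ : ℝ, τ ≤ ∑ σ, ∑ a, ∑ b, ‖x σ a b‖ → ∑ σ, ∑ a, ∑ b, ‖x σ a b‖ ≤ K * τ →
        ∏ σ, (Real.exp (-(cg * t σ)) * (1 + t σ) ^ Ng * (1 + ‖((y σ)ᴴ * x σ * y σ).det‖ ^ (-N'g))) ≤
          C * adelicHeightGL N E (adelicVal F E c N J h) ^ a *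
            (Real.exp (-(c₁ * adelicHeightGL N E (adelicVal F E c N J h) ^ (-(2 : ℝ)) * τ)) * (1 + τ) ^ N₁) *
            ∏ σ, (1 + ‖(x σ).det‖⁻¹) ^ N'₁ := by
  have hT' : ∀ σ, Tinv σ * T σ = 1 := fun σ => mul_eq_one_comm.1 (hT σ)
  obtain ⟨c₀, hc₀, hfloor⟩ := exists_adelicHeightGL_floor E N
  -- constants (frame part as in ★ G7-C)
  set cB : ℝ := (Fintype.card (p ⊕ p) : ℝ) ^ 3 * M ^ 3 with hcB
  have hpp1 : (1 : ℝ) ≤ Fintype.card (p ⊕ p) := by exact_mod_cast Fintype.card_pos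
  have hcB1 : 1 ≤ cB := one_le_mul_of_one_le_of_one_le (one_le_pow₀ hpp1) (one_le_pow₀ hM)
  have hcB0 : 0 < cB := lt_of_lt_of_le one_pos hcB1
  have hKt0 : 0 ≤ Kt := zero_le_one.trans hKt
  -- (i): `ε(h) = (|p|⁴ c_B² ‖h‖²)⁻¹`, so `c₁ = cg · (|p|⁴ c_B²)⁻¹`
  set K₁ : ℝ := (Fintype.card p : ℝ) ^ 4 * cB ^ 2 with hK₁
  have hK₁0 : 0 < K₁ := by positivity
  -- (ii): `K₂ = c₀⁻² + Kt |p|² c_B²`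
  set K₂ : ℝ := (c₀ ^ 2)⁻¹ + Kt * (Fintype.card p : ℝ) ^ 2 * cB ^ 2 with hK₂
  have hK₂0 : 0 ≤ K₂ := by positivity
  -- (iii): `A₃ = 2|p|N′g`, `K₃ = ((|p|! c_B^{|p|})²)^{N′g}`, `K₄ = c₀^{−A₃} + K₃`
  set A₃ : ℝ := 2 * (Fintype.card p : ℝ) * N'g with hA₃
  have hA₃0 : 0 ≤ A₃ := by positivity
  set K₃ : ℝ := ((((Fintype.card p).factorial : ℝ) * cB ^ Fintype.card p) ^ 2) ^ N'g with hK₃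
  have hK₃0 : 0 ≤ K₃ := by positivity
  set K₄ : ℝ := c₀ ^ (-A₃) + K₃ with hK₄
  have hK₄0 : 0 ≤ K₄ := add_nonneg (Real.rpow_nonneg hc₀.le _) hK₃0
  refine ⟨K₂ ^ N₁ * K ^ N₁ * (2 * K₄) ^ Fintype.card S, 2 * (N₁ : ℝ) + A₃ * Fintype.card S, cg * K₁⁻¹, by positivity, by positivity,
    by positivity, fun h y b d κ κ' hκ hκ' hκe hκe' hdec x hxdet t htu htl τ hτ hτK => ?_⟩
  set H : ℝ := adelicHeightGL N E (adelicVal F E c N J h) with hH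
  have hHc : c₀ ≤ H := hfloor _
  have hH0 : 0 < H := lt_of_lt_of_le hc₀ hHc
  have hM0 : 0 ≤ M := zero_le_one.trans hM
  -- per place: entries of `y σ`, `(y σ)⁻¹` (★ `block_entry_bounds`)
  have hblk : ∀ σ, (∀ i j, ‖y σ i j‖ ≤ cB * H) ∧ (∀ i j, ‖(y σ)⁻¹ i j‖ ≤ cB * H) ∧ y σ * (y σ)⁻¹ = 1 := by
    intro σ
    have hg := norm_archAt_archPart_apply_le F E c N J (w σ) (hw σ) hc h
    have hmul : ((((archAt F E c N J (w σ) (hw σ) hc (archPart F E c N J h) : archLocal E N J (w σ)) : GL (Fin N) ℂ) : Matrix (Fin N) (Fin N) ℂ)) *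
        ((((archAt F E c N J (w σ) (hw σ) hc (archPart F E c N J h))⁻¹ : archLocal E N J (w σ)) : GL (Fin N) ℂ) : Matrix (Fin N) (Fin N) ℂ) = 1 := by
      rw [Subgroup.coe_inv, Matrix.coe_units_inv, Matrix.mul_nonsing_inv _ (Matrix.isUnits_det_units _)]
    exact block_entry_bounds r (hT σ) (hT' σ) (hκ σ) (hκ' σ) hM0 (hTe σ) (hTe' σ) (hκe σ) (hκe' σ) hmul hH0.le
      (fun i j => (hg i j).1) (fun i j => (hg i j).2) (hdec σ)
  have hR0 : 0 ≤ cB * H := by positivity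
  -- sizes: `u σ = Σ‖x σ‖ ≥ 0`, `t σ ≥ 0`, `τ ≥ 0`
  obtain ⟨a₀⟩ := (‹Nonempty p› : Nonempty p)
  have hu0 : ∀ σ, 0 ≤ ∑ a, ∑ b, ‖x σ a b‖ := fun σ => Finset.sum_nonneg fun a _ => Finset.sum_nonneg fun b _ => norm_nonneg _
  have hsum0 : 0 ≤ ∑ σ, ∑ a, ∑ b, ‖x σ a b‖ := Finset.sum_nonneg fun σ _ => hu0 σ
  have ht0 : ∀ σ, 0 ≤ t σ := fun σ => (norm_nonneg _).trans (htu σ a₀ a₀)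
  have hK0 : 0 < K := lt_of_lt_of_le one_pos hK
  have hτ0 : 0 ≤ τ := (mul_nonneg_iff_of_pos_left hK0).1 (hsum0.trans hτK)
  -- the entries of the twisted index against the block size
  have hZe : ∀ σ, ∑ a, ∑ b, ‖((y σ)ᴴ * x σ * y σ) a b‖ ≤ (Fintype.card p : ℝ) ^ 2 * (cB * H) ^ 2 * ∑ c, ∑ d, ‖x σ c d‖ := by
    intro σ
    have h2 : ∑ a, ∑ b, ‖((y σ)ᴴ * x σ * y σ) a b‖ ≤ ∑ _a : p, ∑ _b : p, (cB * H) ^ 2 * ∑ c, ∑ d, ‖x σ c d‖ :=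
      Finset.sum_le_sum fun a _ => Finset.sum_le_sum fun b _ => norm_apply_conjTranspose_mul_mul_le hR0 (hblk σ).1 a b
    rw [Finset.sum_const, Finset.sum_const, Finset.card_univ, smul_smul, nsmul_eq_mul] at h2
    refine h2.trans (le_of_eq ?_)
    push_cast; ring
  -- the two comparisons of `t σ` with the block size
  have htup : ∀ σ, t σ ≤ Kt * (Fintype.card p : ℝ) ^ 2 * cB ^ 2 * H ^ 2 * ∑ a, ∑ b, ‖x σ a b‖ := by
    intro σ
    calc t σ ≤ Kt * ∑ a, ∑ b, ‖((y σ)ᴴ * x σ * y σ) a b‖ := htl σ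
      _ ≤ Kt * ((Fintype.card p : ℝ) ^ 2 * (cB * H) ^ 2 * ∑ c, ∑ d, ‖x σ c d‖) := mul_le_mul_of_nonneg_left (hZe σ) hKt0
      _ = Kt * (Fintype.card p : ℝ) ^ 2 * cB ^ 2 * H ^ 2 * ∑ a, ∑ b, ‖x σ a b‖ := by ring
  have htlow : ∀ σ, ∑ a, ∑ b, ‖x σ a b‖ ≤ K₁ * H ^ 2 * t σ := by
    intro σ
    have hxe : ∀ c d, ‖x σ c d‖ ≤ (cB * H) ^ 2 * ∑ a, ∑ b, ‖((y σ)ᴴ * x σ * y σ) a b‖ := fun c d => by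
      have hx := eq_conjTranspose_inv_mul_mul_inv (x := x σ) (hblk σ).2.2
      have h := norm_apply_conjTranspose_mul_mul_le (x := (y σ)ᴴ * x σ * y σ) hR0 (hblk σ).2.1 c d
      rw [← hx] at h
      exact h
    have hZt : ∑ a, ∑ b, ‖((y σ)ᴴ * x σ * y σ) a b‖ ≤ ∑ _a : p, ∑ _b : p, t σ :=
      Finset.sum_le_sum fun a _ => Finset.sum_le_sum fun b _ => htu σ a b
    rw [Finset.sum_const, Finset.sum_const, Finset.card_univ, smul_smul, nsmul_eq_mul] at hZt
    calc ∑ c, ∑ d, ‖x σ c d‖ ≤ ∑ _c : p, ∑ _d : p, (cB * H) ^ 2 * ∑ a, ∑ b, ‖((y σ)ᴴ * x σ * y σ) a b‖ :=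
          Finset.sum_le_sum fun c _ => Finset.sum_le_sum fun d _ => hxe c d
      _ = (Fintype.card p * Fintype.card p : ℕ) * ((cB * H) ^ 2 * ∑ a, ∑ b, ‖((y σ)ᴴ * x σ * y σ) a b‖) := by
          rw [Finset.sum_const, Finset.sum_const, Finset.card_univ, smul_smul, nsmul_eq_mul]
      _ ≤ (Fintype.card p * Fintype.card p : ℕ) * ((cB * H) ^ 2 * ((Fintype.card p * Fintype.card p : ℕ) * t σ)) :=
          mul_le_mul_of_nonneg_left (mul_le_mul_of_nonneg_left hZt (by positivity)) (Nat.cast_nonneg _)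
      _ = K₁ * H ^ 2 * t σ := by rw [hK₁]; push_cast; ring
  /- FACTOR (i): the decay -/
  have hdecay : ∏ σ, Real.exp (-(cg * t σ)) ≤ Real.exp (-(cg * K₁⁻¹ * H ^ (-(2 : ℝ)) * τ)) := by
    rw [← Real.exp_sum, Real.exp_le_exp]
    have hH2 : H ^ (-(2 : ℝ)) = (H ^ 2)⁻¹ := by rw [Real.rpow_neg hH0.le, show H ^ (2 : ℝ) = H ^ 2 by norm_cast]
    have hεu : ∀ σ, K₁⁻¹ * (H ^ 2)⁻¹ * ∑ a, ∑ b, ‖x σ a b‖ ≤ t σ := fun σ => by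
      rw [← mul_inv, inv_mul_le_iff₀ (by positivity)]
      exact htlow σ
    have hkey : K₁⁻¹ * (H ^ 2)⁻¹ * τ ≤ K₁⁻¹ * (H ^ 2)⁻¹ * ∑ σ, ∑ a, ∑ b, ‖x σ a b‖ := mul_le_mul_of_nonneg_left hτ (by positivity)
    rw [hH2]
    calc ∑ σ, -(cg * t σ) ≤ ∑ σ, -(cg * (K₁⁻¹ * (H ^ 2)⁻¹ * ∑ a, ∑ b, ‖x σ a b‖)) :=
          Finset.sum_le_sum fun σ _ => neg_le_neg (mul_le_mul_of_nonneg_left (hεu σ) hcg.le)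
      _ = -(cg * (K₁⁻¹ * (H ^ 2)⁻¹ * ∑ σ, ∑ a, ∑ b, ‖x σ a b‖)) := by rw [Finset.sum_neg_distrib, ← Finset.mul_sum, ← Finset.mul_sum]
      _ ≤ -(cg * (K₁⁻¹ * (H ^ 2)⁻¹ * τ)) := neg_le_neg (mul_le_mul_of_nonneg_left hkey hcg.le)
      _ = -(cg * K₁⁻¹ * (H ^ 2)⁻¹ * τ) := by ring
  /- FACTOR (ii): the polynomial factor, `(1 + t σ)^{Ng} ≤ B^{Ng}`, `B = K₂ ‖h‖² (1 + Σ u) ≥ 1` -/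
  have hpoly : ∏ σ, (1 + t σ) ^ Ng ≤ K₂ ^ N₁ * K ^ N₁ * (H ^ (2 * (N₁ : ℝ)) * (1 + τ) ^ N₁) := by
    have hK₂H : 1 ≤ (c₀ ^ 2)⁻¹ * H ^ 2 := by
      rw [inv_mul_eq_div, one_le_div (by positivity)]
      exact pow_le_pow_left₀ hc₀.le hHc 2
    set B : ℝ := K₂ * H ^ 2 * (1 + ∑ σ, ∑ a, ∑ b, ‖x σ a b‖) with hB
    have hcoef : 0 ≤ Kt * (Fintype.card p : ℝ) ^ 2 * cB ^ 2 * H ^ 2 := by positivity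
    have hK₂H1 : 1 ≤ K₂ * H ^ 2 := by
      rw [hK₂]
      linarith
    have hB1 : 1 ≤ B := one_le_mul_of_one_le_of_one_le hK₂H1 (by linarith)
    have hB0 : 0 ≤ B := zero_le_one.trans hB1
    have h1t : ∀ σ, 1 + t σ ≤ B := by
      intro σ
      have h1 := htup σ
      have hu := hu0 σ
      have hus : ∑ a, ∑ b, ‖x σ a b‖ ≤ ∑ σ', ∑ a, ∑ b, ‖x σ' a b‖ := Finset.single_le_sum (fun σ' _ => hu0 σ') (Finset.mem_univ σ)
      have hm1 : Kt * (Fintype.card p : ℝ) ^ 2 * cB ^ 2 * H ^ 2 * ∑ a, ∑ b, ‖x σ a b‖ ≤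
          Kt * (Fintype.card p : ℝ) ^ 2 * cB ^ 2 * H ^ 2 * ∑ σ', ∑ a, ∑ b, ‖x σ' a b‖ := mul_le_mul_of_nonneg_left hus hcoef
      have hm2 : 0 ≤ (c₀ ^ 2)⁻¹ * H ^ 2 * ∑ σ', ∑ a, ∑ b, ‖x σ' a b‖ := mul_nonneg (by positivity) hsum0
      rw [hB, hK₂]
      linarith
    calc ∏ σ, (1 + t σ) ^ Ng ≤ ∏ _σ : S, B ^ Ng :=
          Finset.prod_le_prod (fun σ _ => Real.rpow_nonneg (by linarith [ht0 σ]) _) fun σ _ => Real.rpow_le_rpow (by linarith [ht0 σ]) (h1t σ) hNg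
      _ = B ^ (Ng * Fintype.card S) := by rw [Finset.prod_const, Finset.card_univ, ← Real.rpow_natCast, ← Real.rpow_mul hB0]
      _ ≤ B ^ (N₁ : ℝ) := Real.rpow_le_rpow_of_exponent_le hB1 hN₁
      _ = (K₂ * H ^ 2) ^ N₁ * (1 + ∑ σ, ∑ a, ∑ b, ‖x σ a b‖) ^ N₁ := by rw [Real.rpow_natCast, hB, mul_pow]
      _ ≤ (K₂ * H ^ 2) ^ N₁ * (K * (1 + τ)) ^ N₁ :=
          mul_le_mul_of_nonneg_left (pow_le_pow_left₀ (by linarith) (by linarith) N₁) (pow_nonneg (by positivity) _)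
      _ = K₂ ^ N₁ * K ^ N₁ * ((H ^ 2) ^ N₁ * (1 + τ) ^ N₁) := by rw [mul_pow, mul_pow]; ring
      _ = K₂ ^ N₁ * K ^ N₁ * (H ^ (2 * (N₁ : ℝ)) * (1 + τ) ^ N₁) := by
          rw [← Real.rpow_natCast (H ^ 2) N₁, ← Real.rpow_natCast H 2, ← Real.rpow_mul hH0.le]
          norm_num
  /- FACTOR (iii): the determinant factor -/
  have h3 : 1 ≤ c₀ ^ (-A₃) * H ^ A₃ := by
    rw [Real.rpow_neg hc₀.le, inv_mul_eq_div, one_le_div (Real.rpow_pos_of_pos hc₀ _)]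
    exact Real.rpow_le_rpow hc₀.le hHc hA₃0
  have hdetσ : ∀ σ, 1 + ‖((y σ)ᴴ * x σ * y σ).det‖ ^ (-N'g) ≤ (2 * K₄ * H ^ A₃) * (1 + ‖(x σ).det‖⁻¹) ^ N'₁ := by
    intro σ
    have hD0 : 0 < ‖(x σ).det‖ := norm_pos_iff.2 (hxdet σ)
    have hv : ((y σ * (y σ)ᴴ).det).re = ‖(y σ).det‖ ^ 2 := re_det_mul_conjTranspose (y σ)
    have hv0 : 0 ≤ ‖(y σ).det‖ ^ 2 := sq_nonneg _
    rw [norm_det_conjTranspose_mul_mul]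
    refine (one_add_mul_rpow_neg_le_mul hD0.le hv0 N'g).trans ?_
    have hA : 1 + ‖(x σ).det‖ ^ (-N'g) ≤ 2 * (1 + ‖(x σ).det‖⁻¹) ^ N'₁ := one_add_rpow_neg_le_two_mul_pow hD0 hN'g hN'₁
    have hBd : 1 + (‖(y σ).det‖ ^ 2) ^ (-N'g) ≤ K₄ * H ^ A₃ := by
      rw [← hv]
      have h1 := rpow_neg_re_det_le (hblk σ).2.2 (hblk σ).1 (hblk σ).2.1 N'g
      rw [abs_of_nonneg hN'g] at h1
      have h2 : ((((Fintype.card p).factorial : ℝ) * (cB * H) ^ Fintype.card p) ^ 2) ^ N'g = K₃ * H ^ A₃ := by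
        have hsplit : ((((Fintype.card p).factorial : ℝ) * (cB * H) ^ Fintype.card p) ^ 2) =
            ((((Fintype.card p).factorial : ℝ) * cB ^ Fintype.card p) ^ 2) * (H ^ 2) ^ Fintype.card p := by ring
        rw [hsplit, Real.mul_rpow (by positivity) (by positivity), hK₃, hA₃]
        congr 1
        rw [← Real.rpow_natCast (H ^ 2) (Fintype.card p), ← Real.rpow_natCast H 2, ← Real.rpow_mul hH0.le, ← Real.rpow_mul hH0.le]
        norm_num
      rw [h2] at h1
      calc 1 + (((y σ * (y σ)ᴴ).det).re) ^ (-N'g) ≤ c₀ ^ (-A₃) * H ^ A₃ + K₃ * H ^ A₃ := add_le_add h3 h1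
        _ = K₄ * H ^ A₃ := by rw [hK₄]; ring
    have hA0 : 0 ≤ 1 + (‖(y σ).det‖ ^ 2) ^ (-N'g) := by positivity
    calc (1 + ‖(x σ).det‖ ^ (-N'g)) * (1 + (‖(y σ).det‖ ^ 2) ^ (-N'g)) ≤ (2 * (1 + ‖(x σ).det‖⁻¹) ^ N'₁) * (K₄ * H ^ A₃) :=
          mul_le_mul hA hBd hA0 (by positivity)
      _ = (2 * K₄ * H ^ A₃) * (1 + ‖(x σ).det‖⁻¹) ^ N'₁ := by ring
  have hQ0 : ∀ σ, 0 ≤ 1 + ‖((y σ)ᴴ * x σ * y σ).det‖ ^ (-N'g) := fun σ => by positivity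
  have hdet : ∏ σ, (1 + ‖((y σ)ᴴ * x σ * y σ).det‖ ^ (-N'g)) ≤
      (2 * K₄) ^ Fintype.card S * H ^ (A₃ * Fintype.card S) * ∏ σ, (1 + ‖(x σ).det‖⁻¹) ^ N'₁ := by
    calc ∏ σ, (1 + ‖((y σ)ᴴ * x σ * y σ).det‖ ^ (-N'g)) ≤ ∏ σ, ((2 * K₄ * H ^ A₃) * (1 + ‖(x σ).det‖⁻¹) ^ N'₁) :=
          Finset.prod_le_prod (fun σ _ => hQ0 σ) fun σ _ => hdetσ σ
      _ = (2 * K₄ * H ^ A₃) ^ Fintype.card S * ∏ σ, (1 + ‖(x σ).det‖⁻¹) ^ N'₁ := by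
          rw [Finset.prod_mul_distrib, Finset.prod_const, Finset.card_univ]
      _ = (2 * K₄) ^ Fintype.card S * H ^ (A₃ * Fintype.card S) * ∏ σ, (1 + ‖(x σ).det‖⁻¹) ^ N'₁ := by
          rw [mul_pow, ← Real.rpow_natCast (H ^ A₃) (Fintype.card S), ← Real.rpow_mul hH0.le]
  /- ASSEMBLY -/
  have hP0 : 0 ≤ ∏ σ, (1 + t σ) ^ Ng := Finset.prod_nonneg fun σ _ => Real.rpow_nonneg (by linarith [ht0 σ]) _
  have hQ0' : 0 ≤ ∏ σ, (1 + ‖((y σ)ᴴ * x σ * y σ).det‖ ^ (-N'g)) := Finset.prod_nonneg fun σ _ => hQ0 σ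
  have hX₁0 : 0 ≤ Real.exp (-(cg * K₁⁻¹ * H ^ (-(2 : ℝ)) * τ)) := (Real.exp_pos _).le
  have hX₂0 : 0 ≤ K₂ ^ N₁ * K ^ N₁ * (H ^ (2 * (N₁ : ℝ)) * (1 + τ) ^ N₁) := by positivity
  have hHa : H ^ (2 * (N₁ : ℝ) + A₃ * Fintype.card S) = H ^ (2 * (N₁ : ℝ)) * H ^ (A₃ * Fintype.card S) := Real.rpow_add hH0 _ _
  calc ∏ σ, (Real.exp (-(cg * t σ)) * (1 + t σ) ^ Ng * (1 + ‖((y σ)ᴴ * x σ * y σ).det‖ ^ (-N'g)))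
        = (∏ σ, Real.exp (-(cg * t σ))) * (∏ σ, (1 + t σ) ^ Ng) * ∏ σ, (1 + ‖((y σ)ᴴ * x σ * y σ).det‖ ^ (-N'g)) := by
          rw [Finset.prod_mul_distrib, Finset.prod_mul_distrib]
    _ ≤ Real.exp (-(cg * K₁⁻¹ * H ^ (-(2 : ℝ)) * τ)) * (K₂ ^ N₁ * K ^ N₁ * (H ^ (2 * (N₁ : ℝ)) * (1 + τ) ^ N₁)) *
          ((2 * K₄) ^ Fintype.card S * H ^ (A₃ * Fintype.card S) * ∏ σ, (1 + ‖(x σ).det‖⁻¹) ^ N'₁) :=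
        mul_le_mul (mul_le_mul hdecay hpoly hP0 hX₁0) hdet hQ0' (mul_nonneg hX₁0 hX₂0)
    _ = K₂ ^ N₁ * K ^ N₁ * (2 * K₄) ^ Fintype.card S * H ^ (2 * (N₁ : ℝ) + A₃ * Fintype.card S) *
          (Real.exp (-(cg * K₁⁻¹ * H ^ (-(2 : ℝ)) * τ)) * (1 + τ) ^ N₁) * ∏ σ, (1 + ‖(x σ).det‖⁻¹) ^ N'₁ := by
        rw [hHa]; ring

end Face

end Summit.HodgeConjecture.HodgeConjecture.Cruxes.HLiu418.K2LiuSiegelEisensteinKindWArchBlockIndefinite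

end
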